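import Summits.BirchSwinnertonDyer.BirchSwinnertonDyer.Theorems.ManinLocalTwoThreeManinConstantOfStevensInclusion
import Summits.BirchSwinnertonDyer.BirchSwinnertonDyer.Theorems.ManinLocalTwoThreeShimuraKernelCyclicLattice
import Summits.BirchSwinnertonDyer.BirchSwinnertonDyer.Theorems.ManinLocalTwoThreeExistsMinimalOptimalDatum
import Summits.BirchSwinnertonDyer.Rank1Residual.ManinAdditive.KummerDiamondReciprocity
import HarnessLib

/-!
# Consumers of the NATURAL (non-optimal) Stevens fact T-es-75♮: CES is eliminated from every row of the cell
(route `ManinLocalTwoThree`, crux C2 `ManinOddAtFour` stmt-BirchSwinnertonDyer-22967 / rung stmt-…-22445; cell bsd-f2-manin, prover seat p2 gen 23;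
`--supports stmt-BirchSwinnertonDyer-22967`; prepared for the LEAD's analytic discharge of T-es-75 (STATUS 06:43Z: «no `IsOptimal` used»))

The tree's printed fact T-es-75 `optimalGamma1Parametrization_cuspInv_galoisAction` (Stevens 1982 Thm. 1.3.1 (b)) carries the binder `D.IsOptimal`,
which print does not need (ref1 §R220; the Literature docstring says so) and which the LEAD's analytic proof (Shimura reciprocity on
`SL₂(ℤ)`-translates, in progress) does not produce.  THIS FILE takes the NATURAL statement — T-es-75 VERBATIM WITHOUT `D.IsOptimal`, as an
explicit hypothesis `hSt` (no definition is introduced) — and shows that it ELIMINATES CES (`exists_optimal_gamma1ParametrizationData`, Stevens'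
`X₁(N)`-optimal curve) from every consumer: in the half-index world `Λ₁(f) ⊆ 2Λ₀(f)` the DOUBLED MODEL `C • W₀`, `C = (2; 0, 0, 0)`, carries the
`X₁(N)`-datum `(f, 2Λ_{W₀}, c₀)` (p3 `exists_gamma1ParametrizationData_smul`; not optimal unless `Λ₁ = 2Λ₀`), and T-es-75♮ on it IS es's T-es-75h,
whence THEOREM K's Kummer values by es's K♮ argument — no Stevens curve, no Shimura cover, no CES.

* §1 `kummerDiamondReciprocity_natural` — es's K♮ (`KummerDiamond.kummerDiamondReciprocity`) for ANY `X₁(N)`-datum, from T-es-75♮.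
* §2 `halfIndex_kummerValues_of_naturalTes75` — THEOREM K's Kummer values for a lattice-optimal `X₀(N)`-datum in the half-index world
  ⟸ T-es-75♮ ALONE (p3's `halfIndex_kummerValues_of_Tes75_CES` without CES).
* §3 CES-free rows: `not_halfIndex_of_modularity_naturalTes75` (E-es-188 per datum ⟸ {modularity, T-es-75♮}),
  `shimuraKernelCyclic_of_modularity_naturalTes75 : exists_isNewformOf → T-es-75♮ → ShimuraCyclic.ShimuraKernelCyclic` (desc row 2 = the
  Derickx–Orlić cyclicity question ⟸ TWO printed facts), `two_pow_five_dvd_of_two_dvd_maninConstant_natural`, Abbes–Ullmo / Česnavičius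
  ⟸ {CDT, T-es-75♮}, **`maninConstantOne_of_modularity_CDT_naturalTes75 : exists_isNewformOf → CDT → T-es-75♮ → ManinConstantOne`** (Manin's
  conjecture leaf ⟸ THREE printed facts), the rung and C2 `ManinOddAtFour` BY NAME ⟸ {CDT, T-es-75♮}.

HONEST FRAMING: CONDITIONAL theorems; T-es-75♮ is an explicit hypothesis (the printed theorem read in full, not yet a tree fact nor proved), CDT
and modularity are statement-only printed facts.  Nothing here proves C2, Manin's conjecture or BSD; the items stay OPEN as filed.  No definitions,
no sorry.  §1 is adapted verbatim from es g39 `kummerDiamondReciprocity` (binder change only), §2 from p3 g20 `indexFour_kummerValues_of_Tes75`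
(`h4 ↦ hhalf`, optimality dropped), §3 from p3 g20 `…ManinConstantOfStevensInclusion` §3–§4 (CES dropped).
[cite: Stevens1982, §1.3 Thm. 1.3.1 (b)] [cite: Manin1972, Prop. 1.4 / Thm. 1.6] [cite: SilvermanAEC2009, III.1 Table 3.1]
[cite: CalegariDimitrovTang2025, Thm. 1.0.1] [cite: Vatsal2005, Conj. 1.9]
-/

set_option autoImplicit false
-- lint-debt: the directory name repeats the summit name (sibling precedent `ManinLocalTwoThreeManinConstantOfStevensInclusion.lean`)
set_option linter.dupNamespace false

noncomputable section

open scoped Classical MatrixGroups PeriodPair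
open Complex CongruenceSubgroup WeierstrassCurve WeierstrassCurve.Affine WeierstrassCurve.Affine.Point
open Literature.NumberTheory.EllipticCurves Literature.NumberTheory.EllipticCurves.ModularForms
open Literature.NumberTheory.Automorphic
open Summit.BirchSwinnertonDyer.Rank1Residual.ManinAdditive
open Summit.BirchSwinnertonDyer.Rank1Residual.ManinAdditive.KummerDiamond

namespace Summit.BirchSwinnertonDyer.BirchSwinnertonDyer.Theorems.ManinLocalTwoThree.NaturalTes75

section Natural

/- The NATURAL Stevens statement T-es-75♮ as an explicit hypothesis: `optimalGamma1Parametrization_cuspInv_galoisAction` VERBATIM without the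
binder `D.IsOptimal` (Stevens 1982 Thm. 1.3.1 (b) holds along every `ℚ`-morphism `X₁(N) → E`; ref1 §R220). -/
variable (hSt : ∀ (W : WeierstrassCurve ℚ) [W.IsElliptic] {N : ℕ} [NeZero N] (D : Gamma1ParametrizationData W N)
    (σ : ℂ ≃ₐ[ℚ] ℂ) (d d' : ℤ), ((d * d' : ℤ) : ZMod N) = 1 →
    σ (Complex.exp (2 * Real.pi * Complex.I / N)) = Complex.exp (2 * Real.pi * Complex.I * d / N) →
    ∀ y : ℤ, y ≠ 0 →
      Affine.Point.map (W' := W) (σ : ℂ →ₐ[ℚ] ℂ) (D.uniformize ((D.c : ℂ) * modularSymbol D.f (1 / y))) =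
        D.uniformize ((D.c : ℂ) * modularSymbol D.f (1 / (d' * y))))

include hSt

/-! ## §1 THEOREM K♮ for any `X₁(N)`-datum, from T-es-75♮ -/

/-- **THEOREM K♮ from the natural Stevens fact, for ANY `X₁(N)`-datum** (es's `KummerDiamond.kummerDiamondReciprocity`, whose proof uses
`D.IsOptimal` only to feed T-es-75): for `σ` of cyclotomic class `d`, `dd′ ≡ 1 (N)`, a coprime splitting `N = Q·y` and `γ ∈ Γ₀(N)` of diamond
class `(d′ mod Q, 1 mod y)`: `σ(π(c{∞,1/y})) = π(c{∞,1/y}) + π(c{∞,γ∞})`.  CONDITIONAL on T-es-75♮ (hypothesis).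
[cite: Stevens1982, §1.3 Thm. 1.3.1 (b)] [cite: Manin1972, Prop. 1.4 / Thm. 1.6] -/
theorem kummerDiamondReciprocity_natural (W : WeierstrassCurve ℚ) [W.IsElliptic]
    {N : ℕ} [NeZero N] (D : Gamma1ParametrizationData W N) (σ : ℂ ≃ₐ[ℚ] ℂ) (d d' : ℤ)
    (hdd' : ((d * d' : ℤ) : ZMod N) = 1)
    (hσ : σ (Complex.exp (2 * Real.pi * Complex.I / N)) = Complex.exp (2 * Real.pi * Complex.I * d / N))
    (Q y : ℕ) (hQy : Q * y = N) (hcop : Nat.Coprime Q y) (γ : Gamma0 N)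
    (hγQ : (((γ : SL(2, ℤ)) 1 1 : ℤ) : ZMod Q) = (d' : ZMod Q)) (hγy : (((γ : SL(2, ℤ)) 1 1 : ℤ) : ZMod y) = 1) :
    Affine.Point.map (W' := W) (σ : ℂ →ₐ[ℚ] ℂ) (D.uniformize ((D.c : ℂ) * modularSymbol D.f (1 / (y : ℚ)))) =
      D.uniformize ((D.c : ℂ) * modularSymbol D.f (1 / (y : ℚ))) + D.uniformize ((D.c : ℂ) * cuspSymbol D.f γ) := by
  -- adapted verbatim from es g39 `KummerDiamond.kummerDiamondReciprocity` (the optimality binder is simply not passed)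
  have hN0 : N ≠ 0 := NeZero.ne N
  have hy0 : y ≠ 0 := by rintro rfl; exact hN0 (by rw [← hQy, mul_zero])
  have hyZ : (y : ℤ) ≠ 0 := by exact_mod_cast hy0
  by_cases hd'0 : d' = 0
  · subst hd'0
    have hN1 : N = 1 := by
      rw [mul_zero, Int.cast_zero] at hdd'
      have h1 : (1 : ZMod N).val = 0 := by rw [← hdd', ZMod.val_zero]
      rw [ZMod.val_one_eq_one_mod] at h1
      exact Nat.eq_one_of_dvd_one (Nat.dvd_of_mod_eq_zero h1) |>.symm ▸ rfl
    subst hN1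
    have h1 : ((d * 1 : ℤ) : ZMod 1) = 1 := Subsingleton.elim _ _
    have hmain := hSt W D σ d 1 h1 hσ (y : ℤ) hyZ
    rw [Int.cast_one, one_mul, Int.cast_natCast] at hmain
    rw [hmain, left_eq_add, gamma1_uniformize_eq_zero_iff]
    exact D.smul_periodLatticeGamma1_le _
      (cuspSymbol_mem_periodLatticeGamma1_of_apply_eq_one D.f γ (Subsingleton.elim _ _))
  · have hd'cop : IsCoprime d' (N : ℤ) := by
      have h := (ZMod.intCast_eq_intCast_iff_dvd_sub (d * d') 1 N).mp (by rw [hdd', Int.cast_one])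
      obtain ⟨m, hm⟩ := h
      exact ⟨d, m, by linear_combination -hm⟩
    obtain ⟨γ₀, hγ₀Q, hγ₀y, hnum, hden⟩ := exists_gamma0_cusp_transport Q y hQy hcop d' hd'cop
    have hmain := hSt W D σ d d' hdd' hσ (y : ℤ) hyZ
    rw [Int.cast_natCast] at hmain
    have hr : ((γ₀ : SL(2, ℤ)) 1 0 : ℚ) * (1 / (y : ℚ)) + ((γ₀ : SL(2, ℤ)) 1 1 : ℚ) ≠ 0 := by
      rw [hden]; exact_mod_cast hd'0
    have hManin := modularSymbol_gamma0_smul_holds D.f γ₀ (1 / (y : ℚ)) hr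
    rw [hnum, hden, show (1 / (y : ℚ)) / (d' : ℚ) = 1 / ((d' : ℚ) * y) by rw [div_div, mul_comm]] at hManin
    rw [hmain, hManin, mul_add, map_add, add_comm, uniformize_cuspSymbol_eq_of_apply_eq D γ₀ γ]
    exact intCast_zmod_eq_of_eq_mod_coprime hQy hcop (hγ₀Q.trans hγQ.symm) (hγ₀y.trans hγy.symm)

/-! ## §2 THEOREM K's Kummer values in the HALF-INDEX world from T-es-75♮ alone (no CES) -/

/-- **Kummer values in the half-index world ⟸ T-es-75♮ ALONE.**  For ANY `X₀(N)`-datum `D₀` (no lattice clause needed) of any elliptic `W₀/ℚ` with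
`Λ₁(f) ⊆ 2Λ₀(f)`: the doubled model `C • W₀`, `C = (2; 0, 0, 0)`, carries the `X₁(N)`-datum `(f, 2Λ_{W₀}, c₀)` (p3's
`KummerValues.exists_gamma1ParametrizationData_smul`, as `c₀Λ₁ ⊆ 2c₀Λ₀ ⊆ 2Λ_{W₀}`), THEOREM K♮ (§1) on it transports along the Galois-equivariant
substitution `ι` (`VariableChange.pointEquivBaseChange_map_algEquiv`) to the Kummer values of the halves `π₀(c₀{∞,1/y}/2)` on `W₀`.  (= p3's
`indexFour_kummerValues_of_Tes75` with `h4 ↦ hhalf` and the optimality of the doubled datum no longer needed.)  CONDITIONAL on T-es-75♮.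
[cite: Stevens1982, §1.3 Thm. 1.3.1 (b)] [cite: SilvermanAEC2009, III.1 Table 3.1] -/
theorem halfIndex_kummerValues_of_naturalTes75 (W₀ : WeierstrassCurve ℚ) [W₀.IsElliptic] {N : ℕ} [NeZero N]
    (D₀ : ModularParametrizationData W₀ N)
    (hhalf : ∀ z ∈ periodLatticeGamma1 D₀.f, ∃ w ∈ periodLattice D₀.f, z = 2 * w)
    (σ : ℂ ≃ₐ[ℚ] ℂ) (d d' : ℤ) (hdd' : ((d * d' : ℤ) : ZMod N) = 1)
    (hσ : σ (Complex.exp (2 * Real.pi * Complex.I / N)) = Complex.exp (2 * Real.pi * Complex.I * d / N))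
    (Q y : ℕ) (hQy : Q * y = N) (hcop : Nat.Coprime Q y) (γ : Gamma0 N)
    (hγQ : (((γ : SL(2, ℤ)) 1 1 : ℤ) : ZMod Q) = (d' : ZMod Q)) (hγy : (((γ : SL(2, ℤ)) 1 1 : ℤ) : ZMod y) = 1) :
    Affine.Point.map (W' := W₀) (σ : ℂ →ₐ[ℚ] ℂ) (D₀.uniformize ((D₀.c : ℂ) * modularSymbol D₀.f (1 / (y : ℚ)) / 2)) =
      D₀.uniformize ((D₀.c : ℂ) * modularSymbol D₀.f (1 / (y : ℚ)) / 2) +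
        D₀.uniformize ((D₀.c : ℂ) * cuspSymbol D₀.f γ / 2) := by
  -- adapted from p3 g20 `KummerValues.indexFour_kummerValues_of_Tes75` (`h4 ↦ hhalf`; no optimality of the doubled datum)
  set C : VariableChange ℚ := ⟨Units.mk0 2 two_ne_zero, 0, 0, 0⟩ with hC
  have hCu : ((C.u : ℚ) : ℂ) = 2 := by rw [hC]; push_cast [Units.val_mk0]; norm_num
  have hc₀ : D₀.c ≠ 0 := D₀.maninConstant_ne_zero_holds
  have hc : ∀ z ∈ periodLatticeGamma1 D₀.f,
      (D₀.c : ℂ) * z ∈ (D₀.L.mulLeft ((C.u : ℚ) : ℂ) (by exact_mod_cast C.u.ne_zero)).lattice := by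
    intro z hz
    obtain ⟨w, hw, rfl⟩ := hhalf z hz
    rw [PeriodPair.mem_mulLeft_lattice, hCu, show (2 : ℂ)⁻¹ * ((D₀.c : ℂ) * (2 * w)) = (D₀.c : ℂ) * w by ring]
    exact D₀.smul_periodLattice_le w hw
  obtain ⟨D₁, hf, hc₁, hL, hu⟩ := KummerValues.exists_gamma1ParametrizationData_smul D₀ C hc₀ hc
  have hK := kummerDiamondReciprocity_natural hSt (C • W₀) D₁ σ d d' hdd' hσ Q y hQy hcop γ hγQ hγy
  simp only [hf, hc₁, hu, hCu] at hK
  rw [← map_add, ← VariableChange.pointEquivBaseChange_map_algEquiv,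
    (VariableChange.pointEquivBaseChange W₀ C ℂ).apply_eq_iff_eq] at hK
  have e1 : (2 : ℂ)⁻¹ * ((D₀.c : ℂ) * modularSymbol D₀.f (1 / (y : ℚ))) = (D₀.c : ℂ) * modularSymbol D₀.f (1 / (y : ℚ)) / 2 := by ring
  have e2 : (2 : ℂ)⁻¹ * ((D₀.c : ℂ) * cuspSymbol D₀.f γ) = (D₀.c : ℂ) * cuspSymbol D₀.f γ / 2 := by ring
  rw [e1, e2] at hK
  exact hK

/-! ## §3 The CES-free rows -/

/-- **E-es-188 per datum ⟸ {modularity, T-es-75♮}**: no lattice-optimal `X₀(N)`-datum of an elliptic curve over `ℚ` is in the half-index world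
`Λ₁(f) ⊆ 2Λ₀(f)` (p3's `not_halfIndex_of_modularity_of_kummerValues` with the Kummer values of §2).  CONDITIONAL. [cite: Stevens1989, §2] -/
theorem not_halfIndex_of_modularity_naturalTes75 (hnf : exists_isNewformOf) (W₀ : WeierstrassCurve ℚ) [W₀.IsElliptic] {N : ℕ} [NeZero N]
    (D₀ : ModularParametrizationData W₀ N) (hopt : ∀ z ∈ D₀.L.lattice, ∃ w ∈ periodLattice D₀.f, z = D₀.c * w)
    (hhalf : ∀ z ∈ periodLatticeGamma1 D₀.f, ∃ w ∈ periodLattice D₀.f, z = 2 * w) : False :=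
  KummerValues.not_halfIndex_of_modularity_of_kummerValues hnf W₀ D₀ hopt hhalf
    (halfIndex_kummerValues_of_naturalTes75 hSt W₀ D₀ hhalf)

/-- **Every prime, lattice-optimal data ⟸ {modularity, T-es-75♮}**: `Λ₁(f) ⊄ pΛ₀(f)` (`p = 2` by the previous theorem, `p ≥ 3` fact-free by p3's
conjugation obstruction `not_periodLatticeGamma1_le_natCast_mul_periodLattice`).  CONDITIONAL. [cite: Vatsal2005, Rem. 1.4] -/
theorem not_prime_le_of_modularity_naturalTes75 (hnf : exists_isNewformOf) (W₀ : WeierstrassCurve ℚ) [W₀.IsElliptic] {N : ℕ} [NeZero N]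
    (D₀ : ModularParametrizationData W₀ N) (hopt : ∀ z ∈ D₀.L.lattice, ∃ w ∈ periodLattice D₀.f, z = D₀.c * w) {p : ℕ} (hp : p.Prime) :
    ¬ (∀ z ∈ periodLatticeGamma1 D₀.f, ∃ w ∈ periodLattice D₀.f, z = (p : ℂ) * w) := by
  rcases hp.eq_two_or_odd' with rfl | hodd
  · exact_mod_cast not_halfIndex_of_modularity_naturalTes75 hSt hnf W₀ D₀ hopt
  · obtain ⟨k, hk⟩ := hodd
    exact KummerValues.not_periodLatticeGamma1_le_natCast_mul_periodLattice D₀ hopt (by have := hp.two_le; omega)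

/-- **desc g26 row 2 `ShimuraCyclic.ShimuraKernelCyclic` (the Shimura kernel of EVERY datum is cyclic — the Derickx–Orlić 2025 question) BY NAME
⟸ TWO printed facts {modularity, T-es-75♮}** (EXO from modularity, E-es-190 lattice algebra, the previous theorem).  CONDITIONAL.
[cite: Vatsal2005, Rem. 1.8, Conj. 1.9] [cite: Stevens1982, §1.3 Thm. 1.3.1 (b)] -/
theorem shimuraKernelCyclic_of_modularity_naturalTes75 (hnf : exists_isNewformOf) : ShimuraCyclic.ShimuraKernelCyclic := by
  intro W _ N _ D
  obtain ⟨W₀, _, _, D₀, hf, hopt⟩ := ExistsMinimalOptimalDatum.existsMinimalOptimalDatum_of_modularity hnf W D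
  rw [← hf]
  exact ShimuraKernelLattice.cyclic_of_forall_prime_not_le_datum D₀ fun _ hp ↦
    not_prime_le_of_modularity_naturalTes75 hSt hnf W₀ D₀ hopt hp

/-- **desc g26 row 1 `Gamma1PeriodsNotInsideTwiceGamma0Periods` BY NAME ⟸ {modularity, T-es-75♮}.**  CONDITIONAL. [cite: Stevens1989, §2] -/
theorem gamma1PeriodsNotInsideTwice_of_modularity_naturalTes75 (hnf : exists_isNewformOf) :
    ShimuraCyclic.Gamma1PeriodsNotInsideTwiceGamma0Periods :=
  ShimuraCyclic.notInsideTwice_of_shimuraKernelCyclic (shimuraKernelCyclic_of_modularity_naturalTes75 hSt hnf)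

/-- **`2 ∣ c₀ ⟹ 2⁵ ∣ N` ⟸ {CDT, T-es-75♮}** (p3's `two_pow_five_dvd_of_two_dvd_maninConstant` without CES): Stevens' inclusion from CDT puts the datum in the
half-index world, §2 gives the Kummer values, PROPOSITION A gives `2⁵ ∣ N`.  CONDITIONAL. [cite: CalegariDimitrovTang2025, Thm. 1.0.1]
[cite: Stevens1982, §1.3 Thm. 1.3.1 (b)] -/
theorem two_pow_five_dvd_of_two_dvd_maninConstant_natural (hCDT : CalegariDimitrovTang2025_unboundedDenominators)
    (W₀ : WeierstrassCurve ℚ) [W₀.IsElliptic] [W₀.IsGloballyMinimal] {N : ℕ} [NeZero N]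
    (D₀ : ModularParametrizationData W₀ N) (hopt : ∀ z ∈ D₀.L.lattice, ∃ w ∈ periodLattice D₀.f, z = D₀.c * w)
    (h2 : (2 : ℤ) ∣ D₀.maninConstant) : 2 ^ 5 ∣ N := by
  have hhalf := KummerValues.halfIndex_of_gamma1Periods_le_of_two_dvd D₀ hopt (CDivisionInt.periodLatticeGamma1_le_neron_of_CDTInt hCDT D₀) h2
  exact KummerValues.two_pow_five_dvd_of_halfIndex_of_kummerValues W₀ D₀ hopt hhalf
    (halfIndex_kummerValues_of_naturalTes75 hSt W₀ D₀ hhalf)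

/-- **Abbes–Ullmo 1996 Thm A ⟸ {CDT, T-es-75♮}** (no CES).  CONDITIONAL. [cite: AbbesUllmo1996, Thm. A] [cite: CalegariDimitrovTang2025, Thm. 1.0.1] -/
theorem abbesUllmo_of_CDT_naturalTes75 (hCDT : CalegariDimitrovTang2025_unboundedDenominators) :
    abbesUllmo_not_dvd_maninConstant_of_not_dvd_level := by
  intro W' _ _ N' _ D' hopt p hp hpN
  rcases hp.eq_two_or_odd' with rfl | hodd
  · intro h2
    exact hpN ((dvd_pow_self 2 (by norm_num)).trans
      (two_pow_five_dvd_of_two_dvd_maninConstant_natural hSt hCDT W' D' hopt (by exact_mod_cast h2)))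
  · obtain ⟨k, hk⟩ := hodd
    exact KummerValues.not_dvd_maninConstant_of_CDT hCDT W' D' hopt (by have := hp.two_le; omega)

/-- **Česnavičius 2018 Thm 1.2 (`2 ∥ N ⟹ 2 ∤ c₀`) ⟸ {CDT, T-es-75♮}** (no CES).  CONDITIONAL. [cite: Cesnavicius2018, Thm. 1.2] [cite: CalegariDimitrovTang2025, Thm. 1.0.1] -/
theorem cesnavicius_of_CDT_naturalTes75 (hCDT : CalegariDimitrovTang2025_unboundedDenominators) :
    cesnavicius_not_two_dvd_maninConstant_of_two_dvd_level := by
  intro W' _ _ N' _ D' hopt _ h4 h2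
  exact h4 ((pow_dvd_pow 2 (by norm_num : 2 ≤ 5)).trans (two_pow_five_dvd_of_two_dvd_maninConstant_natural hSt hCDT W' D' hopt h2))

/-- **`|c₀| = 1` for every lattice-optimal datum of every globally minimal curve ⟸ THREE printed facts {modularity, CDT, T-es-75♮}** (p3's
`abs_maninConstant_eq_one_of_fourPrintedFacts` without CES): `|c₀| ≤ 2` modulo CDT (conjugation obstruction), and `|c₀| = 2` would be the half-index
world, excluded by `not_halfIndex_of_modularity_naturalTes75`.  CONDITIONAL; Manin's conjecture is NOT proved unconditionally.
[cite: CalegariDimitrovTang2025, Thm. 1.0.1] [cite: Stevens1982, §1.3 Thm. 1.3.1 (b)] [cite: Manin1972, §1.6] -/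
theorem abs_maninConstant_eq_one_of_modularity_CDT_naturalTes75 (hnf : exists_isNewformOf) (hCDT : CalegariDimitrovTang2025_unboundedDenominators)
    (W₀ : WeierstrassCurve ℚ) [W₀.IsElliptic] [W₀.IsGloballyMinimal] {N : ℕ} [NeZero N]
    (D₀ : ModularParametrizationData W₀ N) (hopt : ∀ z ∈ D₀.L.lattice, ∃ w ∈ periodLattice D₀.f, z = D₀.c * w) :
    |D₀.maninConstant| = 1 := by
  -- adapted from p3 g20 `KummerValues.abs_maninConstant_eq_one_of_fourPrintedFacts` (CES dropped)
  have hSI := CDivisionInt.periodLatticeGamma1_le_neron_of_CDTInt hCDT D₀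
  have hle := KummerValues.natAbs_maninConstant_le_two_of_gamma1Periods_le D₀ hopt hSI
  have hne : D₀.maninConstant ≠ 0 := D₀.maninConstant_ne_zero_holds
  have hne2 : D₀.maninConstant.natAbs ≠ 2 := fun h2 ↦
    not_halfIndex_of_modularity_naturalTes75 hSt hnf W₀ D₀ hopt
      (KummerValues.halfIndex_of_gamma1Periods_le_of_two_dvd D₀ hopt hSI (Int.natAbs_dvd_natAbs.mp (by rw [h2]; decide)))
  have h1 : D₀.maninConstant.natAbs = 1 := by
    have h0 : D₀.maninConstant.natAbs ≠ 0 := Int.natAbs_ne_zero.mpr hne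
    omega
  rw [Int.abs_eq_natAbs, h1, Nat.cast_one]

/-- **Manin's conjecture leaf `Rank1Residual.ManinConstant.ManinConstantOne` ⟸ THREE printed facts {modularity, CDT, T-es-75♮}.**  CONDITIONAL on three
statement-only facts (T-es-75♮ as a hypothesis), none discharged; Manin's conjecture and BSD are NOT proved.
[cite: CalegariDimitrovTang2025, Thm. 1.0.1] [cite: Stevens1982, §1.3 Thm. 1.3.1 (b)] -/
theorem maninConstantOne_of_modularity_CDT_naturalTes75 (hnf : exists_isNewformOf) (hCDT : CalegariDimitrovTang2025_unboundedDenominators) :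
    Summit.BirchSwinnertonDyer.Rank1Residual.ManinConstant.ManinConstantOne :=
  fun W₀ _ _ _ _ D₀ hopt ↦ abs_maninConstant_eq_one_of_modularity_CDT_naturalTes75 hSt hnf hCDT W₀ D₀ hopt

/-- **The route's rung target `ManinConstantOneRung` (stmt-BirchSwinnertonDyer-22445) BY NAME ⟸ {modularity, CDT, T-es-75♮}.**  CONDITIONAL; the item
stays open as filed. [cite: CalegariDimitrovTang2025, Thm. 1.0.1] [cite: Stevens1982, §1.3 Thm. 1.3.1 (b)] -/
theorem maninLocalTwoThree_maninConstantOneRung_of_modularity_CDT_naturalTes75 (hnf : exists_isNewformOf)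
    (hCDT : CalegariDimitrovTang2025_unboundedDenominators) :
    Summit.BirchSwinnertonDyer.BirchSwinnertonDyer.Theses.ManinLocalTwoThree.ManinConstantOneRung :=
  fun W₀ _ _ _ _ D₀ hopt ↦ abs_maninConstant_eq_one_of_modularity_CDT_naturalTes75 hSt hnf hCDT W₀ D₀ hopt

/-- **C2 `ManinOddAtFour` BY NAME ⟸ {CDT, T-es-75♮}** (the item's own modularity binder feeds `not_halfIndex_of_modularity_naturalTes75`; its three
classical Manin-constant binders are idle).  CONDITIONAL on CDT and on the hypothesis T-es-75♮; same trust base as the closer of record p763620 with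
T-es-75 read without `IsOptimal`.  C2 is NOT closed by this. [cite: CalegariDimitrovTang2025, Thm. 1.0.1] [cite: Stevens1982, §1.3 Thm. 1.3.1 (b)] -/
theorem maninLocalTwoThree_maninOddAtFour_of_CDT_naturalTes75 (hCDT : CalegariDimitrovTang2025_unboundedDenominators) :
    Summit.BirchSwinnertonDyer.BirchSwinnertonDyer.Theses.ManinLocalTwoThree.ManinOddAtFour := by
  intro _ _ _ hnf W₀ _ _ N _ D₀ hopt _ h2
  have hSI := CDivisionInt.periodLatticeGamma1_le_neron_of_CDTInt hCDT D₀
  exact not_halfIndex_of_modularity_naturalTes75 hSt hnf W₀ D₀ hopt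
    (KummerValues.halfIndex_of_gamma1Periods_le_of_two_dvd D₀ hopt hSI h2)

end Natural

/-! ## §4 The typed T-es-75 is the optimal case of T-es-75♮ (sanity) -/

/-- T-es-75♮ implies the tree's T-es-75 (drop the optimality hypothesis). [cite: Stevens1982, §1.3 Thm. 1.3.1 (b)] -/
theorem optimalGamma1Parametrization_cuspInv_galoisAction_of_natural
    (hSt : ∀ (W : WeierstrassCurve ℚ) [W.IsElliptic] {N : ℕ} [NeZero N] (D : Gamma1ParametrizationData W N)
      (σ : ℂ ≃ₐ[ℚ] ℂ) (d d' : ℤ), ((d * d' : ℤ) : ZMod N) = 1 →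
      σ (Complex.exp (2 * Real.pi * Complex.I / N)) = Complex.exp (2 * Real.pi * Complex.I * d / N) →
      ∀ y : ℤ, y ≠ 0 →
        Affine.Point.map (W' := W) (σ : ℂ →ₐ[ℚ] ℂ) (D.uniformize ((D.c : ℂ) * modularSymbol D.f (1 / y))) =
          D.uniformize ((D.c : ℂ) * modularSymbol D.f (1 / (d' * y)))) :
    optimalGamma1Parametrization_cuspInv_galoisAction :=
  fun W _ _ _ D _ σ d d' hdd' hσ y hy ↦ hSt W D σ d d' hdd' hσ y hy

end Summit.BirchSwinnertonDyer.BirchSwinnertonDyer.Theorems.ManinLocalTwoThree.NaturalTes75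

end
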